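import Summits.BirchSwinnertonDyer.BirchSwinnertonDyer.Theorems.KatoDescentPotSupersingularFineSelmerControlTools
import Literature.NumberTheory.EllipticCurves.IwasawaEulerCharRankZeroAssemblyProofs
import HarnessLib

/-!
# The FINE CONTROL road: `Sel₀(K_∞, E[p^∞]) = 0` from `Sel_{p^∞}(E/K) = 0` and the absence of
# `K_v`-rational `p`-torsion at the bad places and at `v ∣ p` — Greenberg's Prop. 3.8 for the FINE Selmer
# group, REDUCTION-TYPE-FREE at every place (route `KatoDescentPotSupersingular`, rung K9, cell
# `bsd-potss`; a `--supports … --as helper` file; seat `bsd-potss-k9-c4` g6; ROUTE-FREE; nothing booked,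
# BSD is not proved by any of this)

WHY. The anchor roads to the Conj-A crux `WildFineSelmerCoatesSujatha` (item stmt-BirchSwinnertonDyer-19386;
(A) at `(E,3)` on the ♯ rows, hence the U₀ items 19189/19197) all have the shape «ONE `E[3]`-congruent
anchor `E′` whose own Iwasawa theory certifies (A) at `(E′,3)`» (Lim–Sujatha 2018 Prop. 3.2, tree fact
p445851) — ordinary unit anchors (g4, Greenberg Thm. 4.1), CM anchors (Rubin / Pollack–Rubin), supersingular
unit anchors (g5, Kobayashi 1.2 + Kim 3.15). Each needs the anchor to have GOOD reduction at `3`; the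
census of seat `conjA-anchor` g0 left 149 rows of the crux whose only congruent partners are ADDITIVE at
`3`. The FINE Selmer group needs no reduction hypothesis anywhere: its local condition at `v ∣ p` is plain
local triviality with TORSION coefficients, so the level-`0` control argument of Greenberg's Prop. 3.8
(LNM 1716, pp. 95–96: `Sel_E(ℚ)_p = 0` and `ker g_0 = 0` ⟹ `Sel_E(ℚ_∞)_p^Γ = 0` ⟹ `Sel_E(ℚ_∞)_p = 0`)
runs for `Sel₀` with the local kernels `ker (H¹(K_v, E[p^∞]) → H¹(K_{∞,w}, E[p^∞])) =
H¹(Γ_v, E[p^∞]^{G_{K_{∞,w}}})`, which VANISH as soon as `E[p]` has no non-zero `D_v`-fixed vector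
(`E(K_v)[p] = 0`): `Γ_v` is pro-`p`, and a `p`-group fixing no non-zero vector of a `p`-primary module
fixes none of any submodule on which it acts (tools file, §3). THIS FILE proves, for EVERY number field
`K`, prime `p`, model `W/K` and `ℤ_p`-extension `κ`:

* §4 `resOfLe_layerZero_inf_eq_zero` — a class of `H¹(K, E[p^∞])` vanishing on `Gal(K̄/K_m) ⊓ D`
  vanishes on `D` when no non-zero `p`-torsion of `E[p^∞]` is `D`-fixed (cocycle computation + the
  `p`-group lemma: inflation–restriction with `E[p^∞]^{Gal(K̄/K_m) ⊓ D} = 0`).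
* §5 **`fineSelmerInfty_eq_bot_of_natCard_selmerGroupPInfty_eq_one`** — `#Sel_{p^∞}(E/K) = 1` and no
  `D_v`-fixed `p`-torsion at the places of a finite set `S` off which `W` is good and `v ∤ p` ⟹
  `Sel₀(K_∞, E[p^∞]) = ⊥`; hence (A) at `(W, p)` in the tree's `∃`-form
  (`conjA_of_natCard_selmerGroupPInfty_eq_one`, via p466275's `conjA_of_finite_fineSelmerInfty_pTorsion`).
  The `_of_local` forms accept, at each `v ∈ S` with `v ∤ p`, EITHER the torsion socket OR the classical
  level-`0` local tower kernel socket `localTowerKerPrimary κ K_v 0 = ⊥` of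
  `Rank1Residual/Iwasawa/SelmerInftyTrivialOfLevelZero` (so the tree's Tamagawa / good / additive
  dischargers plug in unchanged); at `v ∣ p` only the torsion socket exists — that is the point.

HONEST FRAMING: unconditional kernel theorems assembled from tree infrastructure (Greenberg's Lemma 3.2
`ZpExtension.mem_range_resOfLe_of_conjH1_eq`, the descent `exists_forall_resOfLe_inf_decomp_eq_zero` and
bridges of p445543/p465839/p466275, Greenberg's Lemma 3.3 at good places
`Greenberg1999.localTowerKerPrimary_eq_bot_of_hasGoodReductionAt`); no named fact, no definition, no
item closed (19386/19197 stay open; class-wide = Coates–Sujatha (A), a named open problem); no census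
number is an input. References: R. Greenberg, LNM 1716 (1999) Prop. 3.8 (pp. 95–96), §3 Lemmas 3.2–3.3
(pp. 86–88), §4 Thm. 4.1 [GreenbergLNM1716]; J. Coates, R. Sujatha, Math. Ann. 331 (2005) §3 (Conjecture A;
`R(E/F^cyc)` and its control) [CoatesSujatha2005]; J.-P. Serre, *Galois Cohomology* I.§2.6, I.§5.1
[SerreGaloisCohomology1997]; L. Washington, GTM 83, §13.1 [Washington1997].
-/

set_option autoImplicit false
-- sibling precedent (`KatoDescentPotSupersingularAssembly.lean`): the directory name repeats the summit name
set_option linter.dupNamespace false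

noncomputable section

open scoped Classical

universe u

namespace Summit.BirchSwinnertonDyer.BirchSwinnertonDyer.Theorems.FineSelmerControl

open NumberField IsDedekindDomain Field
open Literature.NumberTheory.EllipticCurves Literature.NumberTheory.EllipticCurves.GreenbergSelmer
  Literature.NumberTheory.EllipticCurves.ZpExtension
  Literature.NumberTheory.GaloisRepresentations
  Summit.BirchSwinnertonDyer.BirchSwinnertonDyer.Theorems
  Summit.BirchSwinnertonDyer.BirchSwinnertonDyer.Theorems.FineSelmerLeSignedSelmer

/-! ## §4 Vanishing on `Gal(K̄/K_m) ⊓ D` lifts to vanishing on `D` -/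

section Lift

variable {K : Type u} [Field K] (W : WeierstrassCurve K) {p : ℕ} [Fact p.Prime] (κ : ZpExtension K p)

/-- **A class of `H¹(K, E[p^∞])` that vanishes on `Gal(K̄/K_m) ⊓ D` vanishes on `D`**, provided no
non-zero `p`-torsion element of `E[p^∞]` is `D`-fixed. With a cocycle `φ` of the class, principal on
`N = Gal(K̄/K_m) ⊓ D` (`φ = δT` there), the cocycle identities at `τ d = d (d⁻¹ τ d)` (`τ ∈ N`, `d ∈ D`)
give `τ • u_d = u_d` for `u_d = φ(d) − (d T − T)`, so `u_d = 0` by §3 and `φ = δT` on `D`: the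
inflation–restriction sequence `0 → H¹(D/N, E[p^∞]^N) → H¹(D, ·) → H¹(N, ·)` with `E[p^∞]^N = 0`.
[cite: SerreGaloisCohomology1997, I.§2.6 (inflation–restriction)] [cite: GreenbergLNM1716, §3 p. 96] -/
theorem resOfLe_layerZero_inf_eq_zero (D : Subgroup (absoluteGaloisGroup K)) (m : ℕ)
    (hloc : ∀ x : W.geomPrimaryTorsion p, p • x = 0 → (∀ d ∈ D, d • x = x) → x = 0)
    {y : W.subgroupH1 p (κ.layerSubgroup 0)}
    (hy : W.resOfLe p (inf_le_left.trans (κ.layerSubgroup_antitone (Nat.zero_le m)) :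
      κ.layerSubgroup m ⊓ D ≤ κ.layerSubgroup 0) y = 0) :
    W.resOfLe p (inf_le_left : κ.layerSubgroup 0 ⊓ D ≤ κ.layerSubgroup 0) y = 0 := by
  set N : Subgroup (absoluteGaloisGroup K) := κ.layerSubgroup m ⊓ D with hN
  have hNle : N ≤ κ.layerSubgroup 0 := inf_le_left.trans (κ.layerSubgroup_antitone (Nat.zero_le m))
  have htop : ∀ g : absoluteGaloisGroup K, g ∈ κ.layerSubgroup 0 := fun g ↦ by
    rw [ZpExtension.layerSubgroup_zero]; exact Subgroup.mem_top g
  obtain ⟨φ, rfl⟩ := oneCocycleClass_surjective _ y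
  obtain ⟨T, hT⟩ := FineSelmerLeSelmer.exists_principal_of_resH1Hom_oneCocycleClass_eq_zero
    (subgroupInclusion hNle) (AddMonoidHom.id (W.geomPrimaryTorsion p)) (fun _ _ ↦ rfl)
    Function.bijective_id φ hy
  refine FineSelmerLeSelmer.resH1Hom_oneCocycleClass_eq_zero_of_principal
    (subgroupInclusion (inf_le_left : κ.layerSubgroup 0 ⊓ D ≤ κ.layerSubgroup 0))
    (AddMonoidHom.id (W.geomPrimaryTorsion p)) (fun _ _ ↦ rfl) φ (x := T) fun l ↦ ?_
  -- `l = d ∈ D`; the element `u = φ(d) − (d T − T)` is fixed by `N`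
  obtain ⟨hd0, hdD⟩ := Subgroup.mem_inf.1 l.2
  set gd : κ.layerSubgroup 0 := ⟨(l : absoluteGaloisGroup K), hd0⟩ with hgd
  have hgd' : subgroupInclusion (inf_le_left : κ.layerSubgroup 0 ⊓ D ≤ κ.layerSubgroup 0) l = gd :=
    Subtype.ext rfl
  rw [hgd']
  have hu : ∀ τ ∈ N, τ • (φ.1 gd - ((l : absoluteGaloisGroup K) • T - T)) =
      φ.1 gd - ((l : absoluteGaloisGroup K) • T - T) := by
    intro τ hτ
    set gτ : κ.layerSubgroup 0 := ⟨τ, hNle hτ⟩ with hgτ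
    have hτ'N : (l : absoluteGaloisGroup K)⁻¹ * τ * l ∈ N := by
      obtain ⟨hτm, hτD⟩ := Subgroup.mem_inf.1 hτ
      refine Subgroup.mem_inf.2 ⟨?_, D.mul_mem (D.mul_mem (D.inv_mem hdD) hτD) hdD⟩
      have h := (κ.layerSubgroup_normal m).conj_mem τ hτm (l : absoluteGaloisGroup K)⁻¹
      rwa [inv_inv] at h
    set gτ' : κ.layerSubgroup 0 := ⟨(l : absoluteGaloisGroup K)⁻¹ * τ * l, hNle hτ'N⟩ with hgτ'
    have hprod : gτ * gd = gd * gτ' := Subtype.ext (by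
      change τ * (l : absoluteGaloisGroup K) = l * ((l : absoluteGaloisGroup K)⁻¹ * τ * l)
      group)
    -- the cocycle identities (the action of `↥Gal(K̄/K_0)` on `E[p^∞]` is that of `Γ_K`)
    have h1 : φ.1 (gτ * gd) = φ.1 gτ + τ • φ.1 gd := φ.2 gτ gd
    have h2 : φ.1 (gd * gτ') = φ.1 gd + (l : absoluteGaloisGroup K) • φ.1 gτ' := φ.2 gd gτ'
    -- `φ` is principal on `N`
    have e1 : φ.1 gτ = τ • T - T := hT ⟨τ, hτ⟩
    have e2 : φ.1 gτ' = ((l : absoluteGaloisGroup K)⁻¹ * τ * l) • T - T := hT ⟨_, hτ'N⟩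
    have e3 : (l : absoluteGaloisGroup K) • (((l : absoluteGaloisGroup K)⁻¹ * τ * l) • T) =
        τ • ((l : absoluteGaloisGroup K) • T) := by
      rw [smul_smul, smul_smul, show (l : absoluteGaloisGroup K) * ((l : absoluteGaloisGroup K)⁻¹ * τ * l)
        = τ * l by group]
    rw [hprod, h2, e1, e2, smul_sub, e3] at h1
    -- h1 : φ gd + (τ • (l • T) - l • T) = τ • T - T + τ • φ gd
    have h3 : τ • φ.1 gd = φ.1 gd + (τ • ((l : absoluteGaloisGroup K) • T) - (l : absoluteGaloisGroup K) • T)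
        - (τ • T - T) := by
      rw [h1]; abel
    rw [smul_sub, smul_sub, h3]
    abel
  have hu0 : φ.1 gd - ((l : absoluteGaloisGroup K) • T - T) = 0 :=
    eq_zero_of_forall_layer_inf_smul_eq W κ D m hloc _ hu
  rw [sub_eq_zero] at hu0
  exact hu0

end Lift

/-! ## §5 The fine control theorem: `Sel_{p^∞}(E/K) = 0` + no local `p`-torsion on `S` ⟹ `Sel₀(K_∞) = 0` -/

section Control

variable {K : Type u} [Field K] [NumberField K] (W : WeierstrassCurve K) {p : ℕ} [Fact p.Prime]
  (κ : ZpExtension K p)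

/-- A fine Selmer class vanishes on `Gal(K̄/K_∞) ⊓ D_v` at EVERY finite place `v` (the strict condition of
the fine datum at `v ∣ p`, `resOfLe_inf_decomp_eq_zero_of_mem_strictKer_fineLocalDatum`; the `awayKer`
condition at `v ∤ p`), read on a layer-`n` lift `y` (`h_n(y) = c`). [cite: Greenberg1989, §1 p. 98]
[cite: CoatesSujatha2005, §3] -/
theorem resOfLe_ker_inf_decomp_eq_zero_of_mem_fineSelmerInfty {n : ℕ}
    {y : W.subgroupH1 p (κ.layerSubgroup n)} (hc : W.layerToInfty κ n y ∈ W.fineSelmerInfty κ)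
    (v : HeightOneSpectrum (𝓞 K)) :
    W.resOfLe p (inf_le_left.trans (κ.kerSubgroup_le_layerSubgroup n) :
      κ.kerSubgroup ⊓ decomp v ≤ κ.layerSubgroup n) y = 0 := by
  by_cases hv : ((p : ℕ) : 𝓞 K) ∈ v.asIdeal
  · have h := resOfLe_ker_inf_decomp_conjH1_eq_zero_of_mem_fineSelmerInfty W κ hc v hv 1
    rwa [W.conjH1_one_holds p (κ.layerSubgroup n), AddMonoidHom.id_apply] at h
  · have hc' := (mem_strictSelmerGroupOver_iff (H := κ.kerSubgroup) (M := W.geomPrimaryTorsion p)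
      (L := fineData (W.geomPrimaryTorsion p) p) (W.layerToInfty κ n y)).1 hc
    have h1 : W.resOfLe p (inf_le_left : κ.kerSubgroup ⊓ decomp v ≤ κ.kerSubgroup)
        (W.conjH1 p κ.kerSubgroup 1 (W.layerToInfty κ n y)) = 0 := hc'.1 v hv 1
    rw [W.conjH1_one_holds p κ.kerSubgroup, AddMonoidHom.id_apply] at h1
    have h2 := congrArg (fun f ↦ f y)
      (W.resOfLe_comp_holds p (inf_le_left : κ.kerSubgroup ⊓ decomp v ≤ κ.kerSubgroup)
        (κ.kerSubgroup_le_layerSubgroup n))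
    simp only [AddMonoidHom.coe_comp, Function.comp_apply] at h2
    rw [← h2]
    exact h1

/-- **The fine control theorem with both local sockets (Greenberg's Prop. 3.8 for the fine Selmer group).**
Let `W/K` be an elliptic curve over a number field, `p` a prime, `κ` ANY `ℤ_p`-extension of `K`, `S` a finite
set of finite places off which `W` is good and `v ∤ p`, and assume `#Sel_{p^∞}(E/K) = 1`. Suppose that at
every `v ∈ S` ONE of the two local inputs holds: (T) no non-zero `p`-torsion element of `E[p^∞]` is fixed by
the decomposition group `D_v` (`E(K_v)[p] = 0`; torsion coefficients — the only socket available at `v ∣ p`,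
and reduction-type-free), or (C) `v ∤ p` and the classical level-`0` local tower kernel
`𝒦_{v,0}[p^∞] = ker (H¹(K_v, E) → H¹(K_{∞,w}, E))[p^∞]` vanishes (`localTowerKerPrimary … 0 = ⊥`, the socket
of `Rank1Residual/Iwasawa/SelmerInftyTrivialOfLevelZero`, discharged in the tree at good places, at additive
places without rational `p`-torsion, and bounded by `p^{ord_p c_v}` — `LocalTowerKernelCardLeTamagawa`). Then
`Sel₀(K_∞, E[p^∞]) = 0`. Proof: by §1 it suffices that a `γ`-fixed fine class `c` vanishes; `c = h_0(y)` with
`y ∈ H¹(K, E[p^∞])` (Greenberg's Lemma 3.2, `ZpExtension.mem_range_resOfLe_of_conjH1_eq`); at `v ∈ S` of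
type (T) the local triviality of `c` descends to some layer `K_m` (`exists_forall_resOfLe_inf_decomp_eq_zero`)
and lifts to `K` by §4 (`localKerOver_of_mem_awayKer`); at `v ∈ S` of type (C), at good `v ∉ S` (Greenberg's
Lemma 3.3, `Greenberg1999.localTowerKerPrimary_eq_bot_of_hasGoodReductionAt`) and at `∞` (archimedean
splitting) the classical condition holds because `h_0(y)` is a Selmer class; so
`y ∈ Sel_{p^∞}(E/K_0) ≅ Sel_{p^∞}(E/K) = 0` (`natCard_selmerLayer_zero_eq`).
[cite: GreenbergLNM1716, Prop. 3.8 (pp. 95–96) and §3 Lemmas 3.2–3.3 (pp. 86–88)]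
[cite: CoatesSujatha2005, §3 (Conjecture A)] -/
theorem fineSelmerInfty_eq_bot_of_natCard_selmerGroupPInfty_eq_one_of_local [W.IsElliptic]
    (S : Finset (HeightOneSpectrum (𝓞 K)))
    (hS : ∀ v ∉ S, ((p : ℕ) : 𝓞 K) ∉ v.asIdeal ∧ W.HasGoodReductionAt v)
    (h0 : Nat.card (W.selmerGroupPInfty p) = 1)
    (hloc : ∀ v ∈ S,
      (∀ x : W.geomPrimaryTorsion p, p • x = 0 → (∀ d ∈ decomp v, d • x = x) → x = 0) ∨
        (((p : ℕ) : 𝓞 K) ∉ v.asIdeal ∧ W.localTowerKerPrimary κ (v.adicCompletion K) 0 = ⊥)) :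
    W.fineSelmerInfty κ = ⊥ := by
  obtain ⟨γ, hγ⟩ := κ.surjective (Multiplicative.ofAdd 1)
  have hγ' : κ.IsTopGenerator γ := hγ
  refine fineSelmerInfty_eq_bot_of_forall_conjH1_eq W κ hγ' fun c hc hfix ↦ ?_
  -- `c = h_0(y)` (Lemma 3.2 at `n = 0`)
  have hfix' : W.conjH1 p κ.kerSubgroup (γ ^ p ^ 0) c = c := by rwa [pow_zero, pow_one]
  obtain ⟨y, rfl⟩ := ZpExtension.mem_range_resOfLe_of_conjH1_eq κ hγ' 0
    (W.continuous_smul_geomPrimaryTorsion p) (exists_pow_smul_geomPrimaryTorsion_eq_zero W) c hfix'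
  change W.layerToInfty κ 0 y ∈ W.fineSelmerInfty κ at hc
  change W.layerToInfty κ 0 y = 0
  -- `conj_σ y = y` on `H¹(K_0, ·) = H¹(K, ·)`
  have hconj : ∀ σ : absoluteGaloisGroup K, W.conjH1 p (κ.layerSubgroup 0) σ y = y := fun σ ↦ by
    rw [W.conjH1_of_mem_holds p (κ.layerSubgroup 0)
      (show σ ∈ κ.layerSubgroup 0 by rw [ZpExtension.layerSubgroup_zero]; exact Subgroup.mem_top σ),
      AddMonoidHom.id_apply]
  have hsel : W.layerToInfty κ 0 y ∈ W.selmerInfty κ := FineSelmerLeSelmer.fineSelmerInfty_le_selmerInfty W κ hc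
  have hyA : y ∈ W.selmerInftyPreimage κ 0 := (W.mem_selmerInftyPreimage_iff κ 0 y).2 hsel
  -- the classical local condition at `v` from the vanishing of the level-`0` local tower kernel
  have hclass : ∀ v : HeightOneSpectrum (𝓞 K), W.localTowerKerPrimary κ (v.adicCompletion K) 0 = ⊥ →
      W.localResOver p (κ.layerSubgroup 0) (v.adicCompletion K) y = 0 := fun v hv ↦ by
    have hK := W.localResOver_conjH1_mem_localTowerKer_of_mem κ hyA v 1
    rw [hconj 1] at hK
    obtain ⟨k, hk⟩ := W.exists_pow_smul_subgroupH1_layer_eq_zero κ 0 y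
    have hprim : W.localResOver p (κ.layerSubgroup 0) (v.adicCompletion K) y ∈
        W.localTowerKerPrimary κ (v.adicCompletion K) 0 :=
      (W.mem_localTowerKerPrimary_iff κ _ 0 _).2 ⟨hK, k, by rw [← map_nsmul, hk, map_zero]⟩
    rw [hv, AddSubgroup.mem_bot] at hprim
    exact hprim
  -- `y ∈ Sel_{p^∞}(E/K_0)`
  have hmem : y ∈ W.selmerLayer κ 0 := by
    change y ∈ W.selmerGroupOver p (κ.layerSubgroup 0)
    rw [WeierstrassCurve.mem_selmerGroupOver_iff]
    refine ⟨fun v σ ↦ ?_, fun w σ ↦ ?_⟩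
    · rw [hconj σ]
      by_cases hv : v ∈ S
      · rcases hloc v hv with hT | ⟨-, hC⟩
        · -- (T): local triviality of `c` at `v`, descended to a layer `K_m` and lifted to `K` (§4)
          obtain ⟨m₀, hm₀⟩ := exists_forall_resOfLe_inf_decomp_eq_zero W κ v 0
            (resOfLe_ker_inf_decomp_eq_zero_of_mem_fineSelmerInfty W κ hc v)
          have hres := resOfLe_layerZero_inf_eq_zero W κ (decomp v) m₀ hT (hm₀ m₀ (Nat.zero_le _) le_rfl)
          exact FineSelmerLeSelmer.localKerOver_of_mem_awayKer W p (κ.layerSubgroup 0) v hres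
        · -- (C): the classical socket
          exact (WeierstrassCurve.mem_localKerOver_iff _ _ _ _ _).2 (hclass v hC)
      · -- good `v ∉ S`, `v ∤ p`: `𝒦_{v,0}[p^∞] = 0` (Greenberg's Lemma 3.3)
        exact (WeierstrassCurve.mem_localKerOver_iff _ _ _ _ _).2 (hclass v
          (Greenberg1999.localTowerKerPrimary_eq_bot_of_hasGoodReductionAt W κ (hS v hv).1 (hS v hv).2 0))
    · -- archimedean places split completely
      rw [hconj σ, WeierstrassCurve.mem_localKerOver_iff]
      have hK := W.localResOver_conjH1_mem_localTowerKer_of_mem_infinitePlace κ hyA w σ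
      rw [hconj σ, W.localTowerKer_eq_bot_of_forall_mem κ w.Completion 0
        (ZpExtension.resGal_infinitePlace_mem_kerSubgroup κ w), AddSubgroup.mem_bot] at hK
      exact hK
  -- `Sel_{p^∞}(E/K_0) ≅ Sel_{p^∞}(E/K)` is trivial
  have hcard : Nat.card (W.selmerLayer κ 0) = 1 := by rw [W.natCard_selmerLayer_zero_eq κ, h0]
  haveI : Subsingleton (W.selmerLayer κ 0) := (Nat.card_eq_one_iff_unique.1 hcard).1
  have hy0 : (⟨y, hmem⟩ : W.selmerLayer κ 0) = ⟨0, (W.selmerLayer κ 0).zero_mem⟩ := Subsingleton.elim _ _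
  rw [Subtype.ext_iff] at hy0
  change y = 0 at hy0
  rw [hy0, map_zero]

/-- **The fine control theorem, reduction-type-free form (torsion sockets everywhere).** Let `W/K` be an
elliptic curve over a number field, `p` a prime, `κ` ANY `ℤ_p`-extension of `K`, and `S` a finite set of
finite places such that every `v ∉ S` has `v ∤ p` and good reduction. Assume (i) `#Sel_{p^∞}(E/K) = 1`, and
(ii) for every `v ∈ S`, no non-zero `p`-torsion element of `E[p^∞]` is fixed by the decomposition group `D_v`
(`E(K_v)[p] = 0`). Then `Sel₀(K_∞, E[p^∞]) = 0` — with NO hypothesis on the reduction of `W` at the places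
of `S`, in particular at `v ∣ p`. [cite: GreenbergLNM1716, Prop. 3.8 (pp. 95–96) and §3 Lemmas 3.2–3.3 (pp. 86–88)]
[cite: CoatesSujatha2005, §3 (Conjecture A)] -/
theorem fineSelmerInfty_eq_bot_of_natCard_selmerGroupPInfty_eq_one [W.IsElliptic]
    (S : Finset (HeightOneSpectrum (𝓞 K)))
    (hS : ∀ v ∉ S, ((p : ℕ) : 𝓞 K) ∉ v.asIdeal ∧ W.HasGoodReductionAt v)
    (h0 : Nat.card (W.selmerGroupPInfty p) = 1)
    (hloc : ∀ v ∈ S, ∀ x : W.geomPrimaryTorsion p, p • x = 0 → (∀ d ∈ decomp v, d • x = x) → x = 0) :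
    W.fineSelmerInfty κ = ⊥ :=
  fineSelmerInfty_eq_bot_of_natCard_selmerGroupPInfty_eq_one_of_local W κ S hS h0
    fun v hv ↦ Or.inl (hloc v hv)

/-- Pointwise corollary: under the hypotheses of the fine control theorem the `p`-torsion classes of
`Sel₀(K_∞, E[p^∞])` form a finite set (there are none but `0`). [cite: CoatesSujatha2005, §3] -/
theorem finite_fineSelmerInfty_pTorsion_of_eq_bot (h : W.fineSelmerInfty κ = ⊥) :
    Set.Finite {s : W.fineSelmerInfty κ | p • s = 0} := by
  refine (Set.finite_singleton (0 : W.fineSelmerInfty κ)).subset fun s _ ↦ ?_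
  have hs : (s : W.subgroupH1 p κ.kerSubgroup) ∈ (⊥ : AddSubgroup (W.subgroupH1 p κ.kerSubgroup)) :=
    h.le s.2
  rw [AddSubgroup.mem_bot] at hs
  exact Subtype.ext hs

/-- **Coates–Sujatha's (A) at `(W, p)` from the fine control theorem**: under (i) `#Sel_{p^∞}(E/K) = 1`
and (ii) no `D_v`-fixed `p`-torsion at the places of `S`, the Pontryagin dual of `Sel₀(K_∞, E[p^∞])` is
finitely generated over `ℤ_p` (indeed zero) — the tree's `∃`-form of (A), for EVERY `ℤ_p`-extension `κ`.
[cite: CoatesSujatha2005, §3 (Conjecture A)] [cite: GreenbergLNM1716, Prop. 3.8 (pp. 95–96)] -/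
theorem conjA_of_natCard_selmerGroupPInfty_eq_one [W.IsElliptic]
    (S : Finset (HeightOneSpectrum (𝓞 K)))
    (hS : ∀ v ∉ S, ((p : ℕ) : 𝓞 K) ∉ v.asIdeal ∧ W.HasGoodReductionAt v)
    (h0 : Nat.card (W.selmerGroupPInfty p) = 1)
    (hloc : ∀ v ∈ S, ∀ x : W.geomPrimaryTorsion p, p • x = 0 → (∀ d ∈ decomp v, d • x = x) → x = 0) :
    ∃ (γ : absoluteGaloisGroup K) (D : W.FineSelmerDualData κ γ),
      Module.Finite ℤ_[p] (RestrictScalars ℤ_[p] (IwasawaAlgebra p) D.X) := by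
  obtain ⟨γ, hγ⟩ : ∃ γ : absoluteGaloisGroup K, κ.IsTopGenerator γ := κ.surjective (Multiplicative.ofAdd 1)
  exact conjA_of_finite_fineSelmerInfty_pTorsion W κ hγ
    (finite_fineSelmerInfty_pTorsion_of_eq_bot W κ
      (fineSelmerInfty_eq_bot_of_natCard_selmerGroupPInfty_eq_one W κ S hS h0 hloc))

/-- **(A) at `(W, p)` from the fine control theorem with both local sockets** ((T) torsion coefficients —
the only one at `v ∣ p` — or (C) the classical level-`0` local tower kernel at `v ∤ p`).
[cite: CoatesSujatha2005, §3 (Conjecture A)] [cite: GreenbergLNM1716, Prop. 3.8 (pp. 95–96)] -/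
theorem conjA_of_natCard_selmerGroupPInfty_eq_one_of_local [W.IsElliptic]
    (S : Finset (HeightOneSpectrum (𝓞 K)))
    (hS : ∀ v ∉ S, ((p : ℕ) : 𝓞 K) ∉ v.asIdeal ∧ W.HasGoodReductionAt v)
    (h0 : Nat.card (W.selmerGroupPInfty p) = 1)
    (hloc : ∀ v ∈ S,
      (∀ x : W.geomPrimaryTorsion p, p • x = 0 → (∀ d ∈ decomp v, d • x = x) → x = 0) ∨
        (((p : ℕ) : 𝓞 K) ∉ v.asIdeal ∧ W.localTowerKerPrimary κ (v.adicCompletion K) 0 = ⊥)) :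
    ∃ (γ : absoluteGaloisGroup K) (D : W.FineSelmerDualData κ γ),
      Module.Finite ℤ_[p] (RestrictScalars ℤ_[p] (IwasawaAlgebra p) D.X) := by
  obtain ⟨γ, hγ⟩ : ∃ γ : absoluteGaloisGroup K, κ.IsTopGenerator γ := κ.surjective (Multiplicative.ofAdd 1)
  exact conjA_of_finite_fineSelmerInfty_pTorsion W κ hγ
    (finite_fineSelmerInfty_pTorsion_of_eq_bot W κ
      (fineSelmerInfty_eq_bot_of_natCard_selmerGroupPInfty_eq_one_of_local W κ S hS h0 hloc))

end Control

end Summit.BirchSwinnertonDyer.BirchSwinnertonDyer.Theorems.FineSelmerControl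

end
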